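import Summits.NavierStokesRegularity.NavierStokesRegularity.Theses.AdaptedFrequency
import Summits.NavierStokesRegularity.NavierStokesRegularity.Theorems.LiouvilleConjectureNS
import Summits.NavierStokesRegularity.NavierStokesRegularity.Theorems.AdaptedFrequencyFrequencyRigidityMildFrameDriftWindow
import Literature.Analysis.FluidPDE.TypeIAncientMild
import Literature.Analysis.FluidPDE.ClassicalSolutionRescale
import Literature.Analysis.FluidPDE.ClassicalSolutionGlue
import Literature.Analysis.FluidPDE.KNSSAxisymmetricNoSwirl
import Literature.Analysis.FluidPDE.AdaptedBackwardKernel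
import Literature.Analysis.FluidPDE.OseenDuhamelPairCalculus
import HarnessLib

/-!
# Crux `FrequencyRigidity` (stmt-NavierStokesRegularity-2955), line `two-ended-pinning`:
# the UPPER half of the sandwich — the KNSS Liouville conjecture (L) implies the crux

Helper file (lands `--supports stmt-NavierStokesRegularity-2955`; theorems only).

What is proved.

* `isBoundedAncientMildSolution_of_classical_bounded` — **a bounded classical ancient
  Navier–Stokes flow is a bounded ancient mild solution of the tree's duality-form class**
  (`IsBoundedAncientMildSolution 1`, the hypothesis class of `LiouvilleConjectureNS`): every slice is
  weakly divergence free, and the two-time duality identity holds between all `s < t < 0`.  The point: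
  the duality-form class is BLIND to KNSS's parasitic drift `b(t)` (`∫ φ = 0` for a compactly supported
  divergence-free test field, `integral_inner_const_eq_zero_of_isDivFree`), so no Galilean change of
  frame is needed — KNSS's Lemma 3.1 read on a classical solution (the landed
  `MovingAdjointBernoulli.mildFrame_continuousDrift_window`: the Oseen identity of `u` holds up to the
  spatially constant increment `β(t) − β(s)`) and the tree's tested identities for the caloric and the
  Duhamel terms (`integral_inner_heatExtension_comm_of_bound`,
  `integral_inner_oseenDuhamel_eq_neg_intervalIntegral`) give the identity verbatim.
* `sliceConst_of_liouvilleConjectureNS` — **(L) ⇒ every classical Navier–Stokes flow on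
  `ℝ³ × (−∞,0)` (any viscosity `ν > 0`) with the global time-Type-I bound `‖v(t,x)‖ ≤ C/√(−t)` has
  spatially constant slices** (viscosity rescaling `w(s,y) = ν^{−1/2} v(s, √ν y)` to `ν = 1`, a time
  shift by `δ > 0` makes the flow bounded on `(−∞,0)`, the bridge above, (L), and continuity of slices
  turn "a.e. constant" into "constant"); hence `curl v ≡ 0` (`curl_eq_zero_of_liouvilleConjectureNS`).
* `frequencyRigidity_of_liouvilleConjectureNS : LiouvilleConjectureNS → FrequencyRigidity` — the crux
  follows from (L) WITHOUT the frequency clause: a witness has `H(−1) = ∫‖curl v(−1)‖²K(−1) > 0`, but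
  `curl v ≡ 0`.  Likewise Stub 3 of the line (`stub_flatEnstrophyLiouville_of_liouvilleConjectureNS`):
  a flat inhabitant has `H(−1) = A > 0`; and the large-constant stub S3L of skeleton v6
  (`stub_flatEnstrophyLiouville_largeConstant_of_liouvilleConjectureNS`).

So, in Lean, the crux is now SANDWICHED between two named open Liouville problems:
`LiouvilleConjectureNS ⇒ FrequencyRigidity ⇔ Stub 3 ⇒ ∀ α, RSSLiouvilleBounded α` (the last arrow modulo
co-rotating kernels, `Negative/RSSWall.lean`, p84263; the `↔` is `stub_flatReduction`, p91321).  This file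
is CONDITIONAL on (L) only through its last three theorems' explicit hypothesis; nothing is asserted.

## References

* G. Koch, N. Nadirashvili, G. Seregin, V. Šverák, *Liouville theorems for the Navier–Stokes
  equations and applications*, Acta Math. 203 (2009) 83–105 = arXiv:0709.3599, §1 p. 3 (the
  conjecture (L) and the parasitic solutions `u = b(t)`), §3 Lemma 3.1, Remark 4.1 (mild ⇒ weak).
  [KochNadirashviliSereginSverak2009]
* E. B. Fabes, B. F. Jones, N. M. Rivière, Arch. Rational Mech. Anal. 45 (1972), Thm. 2.1 (the
  duality identity). [FabesJonesRiviere1972]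
-/

set_option linter.dupNamespace false

noncomputable section

namespace Summit.NavierStokesRegularity.NavierStokesRegularity.Theorems.FrequencyRigidity.TwoEndedPinning

open Literature.Analysis Literature.Analysis.FluidPDE MeasureTheory Set Filter Topology Function
open scoped RealInnerProductSpace

/-! ### Bounded classical ancient flows are bounded ancient mild solutions (duality form) -/

/-- **The duality identity for a bounded classical ancient flow.**  If `(u, p)` is a classical
solution of the unforced Navier–Stokes system with viscosity `1` on `ℝ³ × (−∞, 0)` and `‖u‖ ≤ L` there,
then the two-time duality identity `IsMildNSSolutionBetween 1 0 u s t` holds for all `s < t < 0`.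
Proof: on the window `(s − 1, 0)` KNSS's Lemma 3.1 read on the classical solution
(`mildFrame_continuousDrift_window`) gives `u(t) = e^{(t−s)Δ}u(s) − B¹_s(u,u)(t) + (β(t) − β(s))` pointwise;
test against a divergence-free test field: the caloric term is symmetric
(`integral_inner_heatExtension_comm_of_bound`), the Duhamel term is the nonlinear term of the identity
(`integral_inner_oseenDuhamel_eq_neg_intervalIntegral`), and the constant drift increment pairs to zero
(`integral_inner_const_eq_zero_of_isDivFree`). [cite: KochNadirashviliSereginSverak2009, §3 Lemma 3.1 and Remark 4.1 (arXiv:0709.3599)] -/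
theorem isMildNSSolutionBetween_of_classical_bounded {u : ℝ → (EuclideanSpace ℝ (Fin 3)) → (EuclideanSpace ℝ (Fin 3))} {p : ℝ → (EuclideanSpace ℝ (Fin 3)) → ℝ} {L : ℝ}
    (h : IsClassicalNSSolutionOn (Iio 0) 1 0 u p) (hL : ∀ t < 0, ∀ x, ‖u t x‖ ≤ L)
    {s t : ℝ} (hst : s < t) (ht : t < 0) : IsMildNSSolutionBetween 1 0 u s t := by
  have hs : s < 0 := hst.trans ht
  -- ## the window `(s - 1, 0)` and the continuous drift
  obtain ⟨K, hK⟩ := MovingAdjointBernoulli.mildFrame_continuousDrift_window L (1 - s) (by linarith)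
  have hwin : IsClassicalNSSolutionOn (Ioo (s - 1) (s - 1 + (1 - s))) 1 0 u p :=
    h.mono (fun τ hτ => by
      simp only [mem_Ioo] at hτ
      simp only [mem_Iio]; linarith [hτ.2]) (isOpen_Ioo.uniqueDiffOn)
  obtain ⟨β, -, -, hβ⟩ := hK (s - 1) u p hwin (fun τ hτ x => hL τ (by
    simp only [mem_Ioo] at hτ; linarith [hτ.2]) x)
  have hut : ∀ y, u t y =
      UnboundedOperators.heatExtension (u s) (t - s) y - oseenDuhamel 1 s u u t y + (β t - β s) := by
    intro y
    have key := hβ s t (by linarith) hst (by linarith) y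
    rw [← key]; abel
  -- ## basic facts about the classical solution
  have hcont : ContinuousOn (uncurry u) (Iio 0 ×ˢ univ) := h.smooth_velocity.continuousOn
  have hslice : ∀ τ < 0, Continuous (u τ) := fun τ hτ =>
    (h.contDiff_velocity (mem_Iio.2 hτ)).continuous
  have hmeas : AEStronglyMeasurable (uncurry u)
      ((volume : Measure (ℝ × (EuclideanSpace ℝ (Fin 3)))).restrict (Ioo s t ×ˢ univ)) :=
    (hcont.mono (prod_mono (fun τ hτ => lt_trans hτ.2 ht) subset_rfl)).aestronglyMeasurable
      (measurableSet_Ioo.prod MeasurableSet.univ)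
  have hL0 : 0 ≤ L := (norm_nonneg _).trans (hL (-1) (by norm_num) 0)
  have huM : ∀ τ ∈ Ioo s t, ∀ y, ‖u τ y‖ ≤ L := fun τ hτ y => hL τ (hτ.2.trans ht) y
  intro φ hφ hdiv
  have hφc : Continuous φ := hφ.contDiff.continuous
  have hφ1 : ContDiff ℝ 1 φ := hφ.contDiff.of_le (by exact_mod_cast le_top)
  -- ## the three tested identities
  have hB := integral_inner_oseenDuhamel_eq_neg_intervalIntegral one_pos hmeas hL0 huM hst le_rfl
    hφ hdiv
  have hA := integral_inner_heatExtension_comm_of_bound ((hslice s hs).aestronglyMeasurable)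
    (fun x => hL s hs x) hφc hφ.hasCompactSupport (sub_pos.2 hst)
  have hC : ∫ x, ⟪β t - β s, φ x⟫ = 0 :=
    integral_inner_const_eq_zero_of_isDivFree (β t - β s) hφ1 hφ.hasCompactSupport hdiv
  -- ## integrability of the pairings
  obtain ⟨K₀, -, hK₀⟩ := exists_norm_oseenDuhamel_bounded_le (E := (EuclideanSpace ℝ (Fin 3)))
  have hiB : Integrable (fun x => ⟪oseenDuhamel 1 s u u t x, φ x⟫) (volume : Measure (EuclideanSpace ℝ (Fin 3))) :=
    integrable_inner_of_norm_le_of_hasCompactSupport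
      (aestronglyMeasurable_oseenDuhamel one_pos hmeas hmeas hL0 huM huM hst le_rfl)
      (fun x => hK₀ one_pos hst hL0 huM huM x) hφc hφ.hasCompactSupport
  have hiU : Integrable (fun x => ⟪u t x, φ x⟫) (volume : Measure (EuclideanSpace ℝ (Fin 3))) :=
    integrable_inner_of_continuous_of_hasCompactSupport (hslice t ht) hφc hφ.hasCompactSupport
  have hiC : Integrable (fun x => ⟪β t - β s, φ x⟫) (volume : Measure (EuclideanSpace ℝ (Fin 3))) :=
    integrable_inner_of_continuous_of_hasCompactSupport continuous_const hφc hφ.hasCompactSupport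
  have hiA : Integrable
      (fun x => ⟪UnboundedOperators.heatExtension (u s) (t - s) x, φ x⟫) (volume : Measure (EuclideanSpace ℝ (Fin 3))) := by
    refine ((hiU.add hiB).sub hiC).congr (Eventually.of_forall fun x => ?_)
    simp only [Pi.add_apply, Pi.sub_apply, hut x, inner_sub_left, inner_add_left]
    ring
  -- ## assemble
  calc ∫ x, ⟪u t x, φ x⟫
      = ∫ x, (⟪UnboundedOperators.heatExtension (u s) (t - s) x, φ x⟫ -
          ⟪oseenDuhamel 1 s u u t x, φ x⟫ + ⟪β t - β s, φ x⟫) := by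
        refine integral_congr_ae (Eventually.of_forall fun x => ?_)
        simp only [hut x, inner_sub_left, inner_add_left]
    _ = (∫ x, ⟪UnboundedOperators.heatExtension (u s) (t - s) x, φ x⟫) -
          (∫ x, ⟪oseenDuhamel 1 s u u t x, φ x⟫) + ∫ x, ⟪β t - β s, φ x⟫ := by
        rw [integral_add, integral_sub hiA hiB]
        · exact hiA.sub hiB
        · exact hiC
    _ = (∫ x, ⟪u s x, heatTest 1 φ (t - s) x⟫) +
          (∫ τ in s..t, ∫ x, ⟪u τ x, convect (u τ) (heatTest 1 φ (t - τ)) x⟫) +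
          ∫ τ in s..t, ∫ x, ⟪(0 : ℝ → (EuclideanSpace ℝ (Fin 3)) → (EuclideanSpace ℝ (Fin 3))) τ x, heatTest 1 φ (t - τ) x⟫ := by
        rw [hA, hB, hC, heatTest_of_pos one_pos (sub_pos.2 hst), one_mul]
        simp

/-- **A bounded classical ancient Navier–Stokes flow (viscosity `1`) is a bounded ancient mild
solution of the duality-form class** `IsBoundedAncientMildSolution 1` of `SelfSimilar.lean` — the
hypothesis class of `LiouvilleConjectureNS` (weakly divergence-free slices by Gauss–Green; the duality
identity by `isMildNSSolutionBetween_of_classical_bounded`; boundedness is the hypothesis).  No mildness or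
pressure hypothesis is needed: the class is blind to the parasitic drift `b(t)`. [cite: KochNadirashviliSereginSverak2009, §1 p. 3 and §3 Lemma 3.1 (arXiv:0709.3599)] -/
theorem isBoundedAncientMildSolution_of_classical_bounded {u : ℝ → (EuclideanSpace ℝ (Fin 3)) → (EuclideanSpace ℝ (Fin 3))} {p : ℝ → (EuclideanSpace ℝ (Fin 3)) → ℝ}
    {L : ℝ} (h : IsClassicalNSSolutionOn (Iio 0) 1 0 u p) (hL : ∀ t < 0, ∀ x, ‖u t x‖ ≤ L) :
    IsBoundedAncientMildSolution 1 u := by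
  refine ⟨⟨fun t ht => ?_, fun s t hst ht => isMildNSSolutionBetween_of_classical_bounded h hL hst ht⟩,
    ⟨L, fun t ht x => hL t ht x⟩⟩
  exact VectorCalculus.IsDivFree.isWeaklyDivFree_holds (h.divFree t ht)
    ((h.contDiff_velocity (mem_Iio.2 ht)).of_le (by exact_mod_cast le_top))

/-! ### (L) ⇒ Type-I classical ancient flows have spatially constant slices -/

/-- The time line `r ↦ 0 + 1·r` pulls `(−∞, 0)` back to itself. [folklore] -/
private theorem preimage_zero_add_one_mul_Iio :
    ((fun r => (0 : ℝ) + 1 * r) ⁻¹' Iio 0) = Iio 0 := by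
  ext r; simp

/-- **Viscosity normalisation on `(−∞,0)`.**  If `(v, q)` is a classical Navier–Stokes flow with
viscosity `ν > 0` and zero force on `ℝ³ × (−∞,0)`, then `w(s, y) = ν^{−1/2} v(s, √ν y)` (with pressure
`ν⁻¹ q(s, √ν y)`) is a classical flow with viscosity `1` and zero force on `ℝ³ × (−∞,0)`
(`IsClassicalNSSolutionOn.stRescale` with `α = ν^{−1/2}`, `γ = √ν`, `β = 1`). [cite: Tao2011, footnote 3] -/
theorem classical_viscosityNormalise {ν : ℝ} (hν : 0 < ν) {v : ℝ → (EuclideanSpace ℝ (Fin 3)) → (EuclideanSpace ℝ (Fin 3))} {q : ℝ → (EuclideanSpace ℝ (Fin 3)) → ℝ}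
    (h : IsClassicalNSSolutionOn (Iio 0) ν 0 v q) :
    IsClassicalNSSolutionOn (Iio 0) 1 0 ((Real.sqrt ν)⁻¹ • stPull 1 (Real.sqrt ν) 0 0 v)
      (((Real.sqrt ν)⁻¹ ^ 2) • stPull 1 (Real.sqrt ν) 0 0 q) := by
  set m : ℝ := Real.sqrt ν with hm
  have hm0 : 0 < m := Real.sqrt_pos.2 hν
  have key := h.stRescale (α := m⁻¹) (β := 1) (γ := m) (inv_pos.2 hm0) hm0
    (by rw [inv_mul_cancel₀ hm0.ne']) 0 0
  have hmm : m * m = ν := by rw [hm]; exact Real.mul_self_sqrt hν.le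
  have hvis : m⁻¹ * ν / m = 1 := by
    rw [← hmm]; field_simp
  have hforce : ((m⁻¹ ^ 2 * m) • stPull 1 m 0 0 (0 : ℝ → (EuclideanSpace ℝ (Fin 3)) → (EuclideanSpace ℝ (Fin 3)))) = 0 := by
    funext s y
    simp [stPull]
  rw [preimage_zero_add_one_mul_Iio, hvis, hforce] at key
  exact key

/-- **Time shift into the past.**  A classical flow on `(−∞,0)` shifted by `δ ≥ 0`,
`s ↦ (w(s − δ), π(s − δ))`, is again a classical flow on `(−∞,0)` (the system is autonomous,
`IsClassicalNSSolutionOn.comp_add_right`, and `(· − δ)⁻¹'(−∞,0) ⊇ (−∞,0)`). [folklore] -/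
theorem classical_shift {ν : ℝ} {w : ℝ → (EuclideanSpace ℝ (Fin 3)) → (EuclideanSpace ℝ (Fin 3))} {π : ℝ → (EuclideanSpace ℝ (Fin 3)) → ℝ}
    (hw : IsClassicalNSSolutionOn (Iio 0) ν 0 w π) {δ : ℝ} (hδ : 0 ≤ δ) :
    IsClassicalNSSolutionOn (Iio 0) ν 0 (fun s => w (s + -δ)) (fun s => π (s + -δ)) := by
  have h1 := hw.comp_add_right (-δ)
  exact h1.mono (fun s hs => by
    simp only [mem_preimage, mem_Iio] at hs ⊢; linarith) isOpen_Iio.uniqueDiffOn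

/-- **(L) ⇒ slices of a Type-I classical ancient flow are spatially constant.**  Assume the KNSS
Liouville conjecture `LiouvilleConjectureNS`.  Let `(v, q)` be a classical Navier–Stokes flow (any
viscosity `ν > 0`, zero force) on `ℝ³ × (−∞,0)` with the global time-Type-I bound
`‖v(t,x)‖ ≤ C/√(−t)`.  Then `v(t, ·)` is constant for every `t < 0`.  Proof: normalise the viscosity,
shift time by `δ = −t/2` (the shifted flow is bounded by `C ν^{−1/2}/√δ` on `(−∞,0)`), apply the bridge
`isBoundedAncientMildSolution_of_classical_bounded` and (L) at the time `t/2`, and upgrade "a.e. constant"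
to "constant" by continuity of the slice (`Continuous.ae_eq_iff_eq`). [cite: KochNadirashviliSereginSverak2009, §1 p. 3 (conjecture (L)) (arXiv:0709.3599)] -/
theorem sliceConst_of_liouvilleConjectureNS (hLiou : LiouvilleConjectureNS) {ν C : ℝ} (hν : 0 < ν)
    {v : ℝ → (EuclideanSpace ℝ (Fin 3)) → (EuclideanSpace ℝ (Fin 3))} {q : ℝ → (EuclideanSpace ℝ (Fin 3)) → ℝ} (h : IsClassicalNSSolutionOn (Iio 0) ν 0 v q)
    (hTI : ∀ t < 0, ∀ x, ‖v t x‖ ≤ C / Real.sqrt (-t)) :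
    ∀ t < 0, ∀ x y, v t x = v t y := by
  intro τ hτ
  set m : ℝ := Real.sqrt ν with hm
  have hm0 : 0 < m := Real.sqrt_pos.2 hν
  have hC0 : 0 ≤ C := by
    have h1 := hTI (-1) (by norm_num) 0
    have h2 : (0 : ℝ) ≤ C / Real.sqrt (-(-1:ℝ)) := (norm_nonneg _).trans h1
    simpa using h2
  -- viscosity `1`
  set w : ℝ → (EuclideanSpace ℝ (Fin 3)) → (EuclideanSpace ℝ (Fin 3)) := m⁻¹ • stPull 1 m 0 0 v with hw_def
  have hw : IsClassicalNSSolutionOn (Iio 0) 1 0 w ((m⁻¹ ^ 2) • stPull 1 m 0 0 q) :=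
    classical_viscosityNormalise hν h
  have hw_apply : ∀ s y, w s y = m⁻¹ • v s (m • y) := by
    intro s y
    simp [hw_def, stPull]
  -- shift by `δ = -τ/2`
  set δ : ℝ := -τ / 2 with hδ
  have hδ0 : 0 < δ := by rw [hδ]; linarith
  set u : ℝ → (EuclideanSpace ℝ (Fin 3)) → (EuclideanSpace ℝ (Fin 3)) := fun s => w (s + -δ) with hu_def
  have hu : IsClassicalNSSolutionOn (Iio 0) 1 0 u (fun s => ((m⁻¹ ^ 2) • stPull 1 m 0 0 q) (s + -δ)) :=
    classical_shift hw hδ0.le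
  -- bounded on `(−∞, 0)`
  have hbound : ∀ s < 0, ∀ y, ‖u s y‖ ≤ m⁻¹ * (C / Real.sqrt δ) := by
    intro s hs y
    have hsd : s + -δ < 0 := by linarith
    have h1 := hTI (s + -δ) hsd (m • y)
    have hsq : Real.sqrt δ ≤ Real.sqrt (-(s + -δ)) := Real.sqrt_le_sqrt (by linarith)
    have h2 : C / Real.sqrt (-(s + -δ)) ≤ C / Real.sqrt δ :=
      div_le_div_of_nonneg_left hC0 (Real.sqrt_pos.2 hδ0) hsq
    calc ‖u s y‖ = ‖m⁻¹ • v (s + -δ) (m • y)‖ := by rw [hu_def]; simp only [hw_apply]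
      _ = m⁻¹ * ‖v (s + -δ) (m • y)‖ := by
          rw [norm_smul, Real.norm_of_nonneg (inv_nonneg.2 hm0.le)]
      _ ≤ m⁻¹ * (C / Real.sqrt δ) :=
          mul_le_mul_of_nonneg_left (h1.trans h2) (inv_nonneg.2 hm0.le)
  have hmild : IsBoundedAncientMildSolution 1 u :=
    isBoundedAncientMildSolution_of_classical_bounded hu hbound
  have hmeas : ∀ s < 0, AEStronglyMeasurable (u s) volume := fun s hs =>
    (hu.contDiff_velocity (mem_Iio.2 hs)).continuous.aestronglyMeasurable
  -- (L) at the time `τ + δ = τ/2`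
  have hτ2 : τ + δ < 0 := by rw [hδ]; linarith
  obtain ⟨b, hb⟩ := hLiou u hmild hmeas (τ + δ) hτ2
  have hcont : Continuous (u (τ + δ)) := (hu.contDiff_velocity (mem_Iio.2 hτ2)).continuous
  have heq : u (τ + δ) = fun _ => b := (Continuous.ae_eq_iff_eq volume hcont continuous_const).1 hb
  have hwτ : ∀ y, w τ y = b := by
    intro y
    have h1 := congrFun heq y
    simp only [hu_def] at h1
    rwa [show τ + δ + -δ = τ by ring] at h1
  -- undo the rescaling
  have hv : ∀ x, v τ x = m • b := by
    intro x
    have h1 := hwτ (m⁻¹ • x)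
    rw [hw_apply, smul_smul, mul_inv_cancel₀ hm0.ne', one_smul] at h1
    rw [← h1, smul_smul, mul_inv_cancel₀ hm0.ne', one_smul]
  intro x y
  rw [hv x, hv y]

/-- **(L) ⇒ a Type-I classical ancient flow is irrotational**: `curl v(t, ·) ≡ 0` for every `t < 0`
(the slice is constant, `sliceConst_of_liouvilleConjectureNS`). [cite: KochNadirashviliSereginSverak2009, §1 p. 3 (arXiv:0709.3599)] -/
theorem curl_eq_zero_of_liouvilleConjectureNS (hLiou : LiouvilleConjectureNS) {ν C : ℝ} (hν : 0 < ν)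
    {v : ℝ → (EuclideanSpace ℝ (Fin 3)) → (EuclideanSpace ℝ (Fin 3))} {q : ℝ → (EuclideanSpace ℝ (Fin 3)) → ℝ} (h : IsClassicalNSSolutionOn (Iio 0) ν 0 v q)
    (hTI : ∀ t < 0, ∀ x, ‖v t x‖ ≤ C / Real.sqrt (-t)) {t : ℝ} (ht : t < 0) (x : (EuclideanSpace ℝ (Fin 3))) :
    curl (v t) x = 0 := by
  have hc : v t = fun _ => v t 0 := funext fun y => sliceConst_of_liouvilleConjectureNS hLiou hν h hTI t ht y 0
  rw [hc]
  simp [curl]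

/-! ### (L) ⇒ the crux, and (L) ⇒ Stub 3 -/

/-- **The upper half of the sandwich: `LiouvilleConjectureNS → FrequencyRigidity`.**  The crux follows
from the KNSS Liouville conjecture WITHOUT its frequency clause: a witness `(ν, C, Λ₀, v, q, K)` has positive
adapted enstrophy `H(−1) = ∫ ‖curl v(−1)‖² K(−1) > 0`, but under (L) `curl v ≡ 0`, so `H(−1) = 0`.
CONDITIONAL on (L) (explicit hypothesis); together with the wall `Negative/RSSWall.lean` this pins the crux
between two open Liouville problems. [cite: KochNadirashviliSereginSverak2009, §1 p. 3 (arXiv:0709.3599)] -/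
theorem frequencyRigidity_of_liouvilleConjectureNS :
    Summit.NavierStokesRegularity.NavierStokesRegularity.LiouvilleConjectureNS → Summit.NavierStokesRegularity.NavierStokesRegularity.Theses.AdaptedFrequency.FrequencyRigidity := by
  intro hLiou
  unfold Theses.AdaptedFrequency.FrequencyRigidity
  rintro ⟨ν, C, Λ₀, v, q, K, hν, hNS, hTI, -, -, -, -, -, -, hF⟩
  have hpos := (hF _ _ rfl rfl).1 (-1) (by norm_num)
  have hzero : (∫ x, ‖curl (v (-1)) x‖ ^ 2 * K (-1) x) = 0 := by
    have hc : ∀ x, curl (v (-1)) x = 0 := fun x =>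
      curl_eq_zero_of_liouvilleConjectureNS hLiou hν hNS (fun t ht x => hTI t ht x) (by norm_num) x
    simp [hc]
  rw [hzero] at hpos
  exact lt_irrefl _ hpos

/-- **(L) ⇒ Stub 3 of line `two-ended-pinning`** (`stub_flatEnstrophyLiouville`, registered signature
verbatim): a flat inhabitant has `H(−1) = A · 1 = A > 0`, but under (L) `curl v ≡ 0` and `H(−1) = 0`.
CONDITIONAL on (L). [cite: KochNadirashviliSereginSverak2009, §1 p. 3 (arXiv:0709.3599)] -/
theorem stub_flatEnstrophyLiouville_of_liouvilleConjectureNS (hLiou : LiouvilleConjectureNS) :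
    ∀ (ν C A : ℝ) (C' : ℕ → ℝ) (v : ℝ → EuclideanSpace ℝ (Fin 3) → EuclideanSpace ℝ (Fin 3))
      (q : ℝ → EuclideanSpace ℝ (Fin 3) → ℝ) (K : ℝ → EuclideanSpace ℝ (Fin 3) → ℝ),
      ¬ (0 < ν ∧ Literature.Analysis.FluidPDE.IsClassicalNSSolutionOn (Set.Iio 0) ν 0 v q ∧
          Literature.Analysis.FluidPDE.HasTypeITimeDecay C v ∧
          (∀ k : ℕ, 1 ≤ k → ∀ t : ℝ, t < 0 → ∀ x : EuclideanSpace ℝ (Fin 3),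
            ‖iteratedFDeriv ℝ k (v t) x‖ ≤ C' k * (-t) ^ (-((k : ℝ) + 1) / 2)) ∧
          Literature.Analysis.FluidPDE.IsAdaptedBackwardKernel ν v (Set.Iio 0) 0 0 K ∧
          Literature.Analysis.FluidPDE.IsGaussianComparable K (Set.Iio 0) 0 0 ∧ 0 < A ∧
          (∀ t : ℝ, t < 0 →
            Literature.Analysis.FluidPDE.adaptedEnstrophy v K t = A * (-t) ^ (-(2 : ℝ))) ∧
          (∀ t : ℝ, t < 0 →
            HasDerivAt (Literature.Analysis.FluidPDE.adaptedEnstrophy v K)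
              (∫ x, (2 * (inner ℝ (Literature.Analysis.FluidPDE.curl (v t) x)
                            (fderiv ℝ (v t) x (Literature.Analysis.FluidPDE.curl (v t) x))
                          - ν * Literature.Analysis.FluidPDE.frobeniusNormSq
                            (fderiv ℝ (Literature.Analysis.FluidPDE.curl (v t)) x))) * K t x) t)) := by
  rintro ν C A C' v q K ⟨hν, hNS, hTI, -, -, -, hA, hflat, -⟩
  have h1 := hflat (-1) (by norm_num)
  have hc : ∀ x, curl (v (-1)) x = 0 := fun x =>
    curl_eq_zero_of_liouvilleConjectureNS hLiou hν hNS (fun t ht x => hTI t ht x) (by norm_num) x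
  have hzero : adaptedEnstrophy v K (-1) = 0 := by
    simp [adaptedEnstrophy, hc]
  rw [hzero] at h1
  norm_num at h1
  linarith

/-- **(L) ⇒ S3L**, the LARGE-constant half of Stub 3 in skeleton v6 (`stub_flatEnstrophyLiouville_largeConstant`,
registered signature verbatim; the size hypothesis is simply not needed under (L)).  CONDITIONAL on (L).
[cite: KochNadirashviliSereginSverak2009, §1 p. 3 (arXiv:0709.3599)] -/
theorem stub_flatEnstrophyLiouville_largeConstant_of_liouvilleConjectureNS (hLiou : LiouvilleConjectureNS) :
    ∀ (ν C A : ℝ) (C' : ℕ → ℝ) (v : ℝ → EuclideanSpace ℝ (Fin 3) → EuclideanSpace ℝ (Fin 3))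
      (q : ℝ → EuclideanSpace ℝ (Fin 3) → ℝ) (K : ℝ → EuclideanSpace ℝ (Fin 3) → ℝ),
      1 / (96 * Literature.Analysis.FluidPDE.oseenSliceConst (EuclideanSpace ℝ (Fin 3))) ≤ C / Real.sqrt ν →
      ¬ (0 < ν ∧ Literature.Analysis.FluidPDE.IsClassicalNSSolutionOn (Set.Iio 0) ν 0 v q ∧
          Literature.Analysis.FluidPDE.HasTypeITimeDecay C v ∧
          (∀ k : ℕ, 1 ≤ k → ∀ t : ℝ, t < 0 → ∀ x : EuclideanSpace ℝ (Fin 3),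
            ‖iteratedFDeriv ℝ k (v t) x‖ ≤ C' k * (-t) ^ (-((k : ℝ) + 1) / 2)) ∧
          Literature.Analysis.FluidPDE.IsAdaptedBackwardKernel ν v (Set.Iio 0) 0 0 K ∧
          Literature.Analysis.FluidPDE.IsGaussianComparable K (Set.Iio 0) 0 0 ∧ 0 < A ∧
          (∀ t : ℝ, t < 0 →
            Literature.Analysis.FluidPDE.adaptedEnstrophy v K t = A * (-t) ^ (-(2 : ℝ))) ∧
          (∀ t : ℝ, t < 0 →
            HasDerivAt (Literature.Analysis.FluidPDE.adaptedEnstrophy v K)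
              (∫ x, (2 * (inner ℝ (Literature.Analysis.FluidPDE.curl (v t) x)
                            (fderiv ℝ (v t) x (Literature.Analysis.FluidPDE.curl (v t) x))
                          - ν * Literature.Analysis.FluidPDE.frobeniusNormSq
                            (fderiv ℝ (Literature.Analysis.FluidPDE.curl (v t)) x))) * K t x) t)) :=
  fun ν C A C' v q K _ => stub_flatEnstrophyLiouville_of_liouvilleConjectureNS hLiou ν C A C' v q K

end Summit.NavierStokesRegularity.NavierStokesRegularity.Theorems.FrequencyRigidity.TwoEndedPinning

end
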